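import Mathlib
import HarnessLib
import HarnessLib.Audit
import Summits.SmoothPoincare4.Statement
import Summits.SmoothPoincare4.SmoothPoincare4.Theses.RootDecompAE
import Literature.Topology.FourManifolds.SmoothTriangulation
import Literature.Topology.FourManifolds.BalancedPresentation
import Literature.Topology.FourManifolds.PresentationHandlebodyFive
import Literature.Topology.FourManifolds.ClosedBall
import Literature.Topology.FourManifolds.CorkDecomposition

/-!
# LINE «grade-four-ac» for the crux `RootDecompAE.DoublesBeyondShadowTwo` (item stmt-SmoothPoincare4-32183)

Planner decomp-sp4-lens-1, generation 14 (lens «grading / quantitative ladder»), species R (recognition).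
Self-contained sibling of the registered grade-one line `Cruxes/DoublesShadowLEOne/Lines/grade_one_ac.lean` and of the
cleared grade-two line `grade_two_ac` (gen13; same model, same conventions; nothing is imported from them).

The crux is the DECLARED RESIDUAL of the glued split of `ContractibleDoublesStandard` (route RootDecompAE rev 3): a double
`X = D(C)` (`C` compact contractible) which is a homotopy 4-sphere and admits NO typed shadow of connected complexity `≤ 2`
is diffeomorphic to `S⁴`.  This line carves out of it EVERY rung the abelian local mechanism of grades one and two can reach:
the rows `c* = 3` and `c* = 4` are closed by stubs 1–4 exactly as at grades one and two, and the rest is the declared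
residual STUB 5 (`DoublesBeyondShadowFour`, the same statement with `4` for `2`), which begins precisely where that mechanism
is CERTIFIED TO STOP (the Poincaré block at `c* = 5`).  What is new:

* §2  GENERIC BLOCK CALCULUS instead of block tables: a block piece is `block s code`, `s` one of the SEVENTEEN shapes
      (connected 4-regular multigraphs on `V ≤ 4` vertices: figure eight; melon, handcuff; `TH`, `L1`, `L2`, `L3`; `Q1 … Q10`)
      and `code` ANY sheet decoration (base 6, one digit per edge); its port words are TRACED (`Block.ports`, a total computable
      function; Python twin `enum/blockcalc.py` reproduces the gen13 tables: 11 / 57 / 116 classes verbatim, local tables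
      205/88/83/5 and 47 520 / 17 800 / 17 800).  Five spine letters per piece.
* §4b SIX registered stubs and the sorry-free composition `DoublesBeyondShadowTwo_of` concluding the crux BY NAME:
      STUB 1 `stub_kmnGraphPresentationFour` (STRUCTURE at `c* ≤ 4`, costume-in-print: KMN arXiv:1803.06713 §2/§4, Turaev,
      H-A-M I Thm 3.4, + the 17-shape classification `enum/shapes4.py`); STUB 2a `stub_ledgerFour` (LOAD-BEARING, conceptual:
      the gen13 OWNERSHIP LEDGER `LocalTableLE4 → GradeFourDichotomy` — tree WLOG, cut excesses, canonical ownership,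
      `|det| = ∏ local minors`, level induction); STUB 2b `stub_localTableFour` (FINITE: the local table (★≤4) «every unimodular
      owned tuple of every block with ≤ 4 true vertices is ROE», stated over the same `Block.localCheck` / `Block.decode` as the
      pieces; `V ≤ 3` CERTIFIED by compiled evaluation in the gen14 instrument file `G14Certificates.lean` over all
      36 + 2·1 296 + 4·46 656 decorations, `V = 4` checked EXHAUSTIVELY by `enum/fast4.py`: 16 796 160 blocks, 1 761 954 owned
      5-tuples, 540 360 unimodular, all ROE, 192 s); STUB 3 `stub_roeSound`; STUB 4 `stub_acFiveBall` (tree fact by name);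
      STUB 5 `stub_beyondShadowFour` (declared residual, `c* ≥ 5`).
* WHERE THE MECHANISM STOPS (gen14 NODE §3, certified in `G14Certificates.lean`): the local lemma (★₅) is FALSE — the
      600-cell modulo the binary icosahedral group gives the K₅ block `B₁₂₀` of the Poincaré sphere (decoration
      `3,4,3,4,3,4,3,3,4,3`, six ports `eFB, DeC, FDA, fCa, CbD, EAb`, exponent determinant `−1`, NO elimination certificate, and
      a nontrivial representation to `A₅` killing all six words).  So the ladder of theorem-grade rungs of this mechanism is
      EXACTLY `c* ≤ 4`, and the residual STUB 5 is the first genuinely Andrews–Curtis-sensitive cell.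
-/

open scoped Manifold ContDiff ContinuousMap Topology
open Literature.Topology.FourManifolds

set_option linter.dupNamespace false

noncomputable section

namespace Summit.SmoothPoincare4.SmoothPoincare4.Cruxes.DoublesBeyondShadowTwo.GradeFourAC

/-! ## §1 The typed object (verbatim copy of the grade-one line §1 / gen10 ShadowDoubles.lean §1) -/

section Typed

variable (n : ℕ) (M : Type*) [TopologicalSpace M] [ChartedSpace (EuclideanSpace ℝ (Fin 4)) M]

/-- `HasConnectedShadowComplexityLE n M`: the smooth 4-manifold `M` admits a (combinatorially presented, locally
flat) shadow of connected complexity `c* ≤ n` (Martelli arXiv:0909.0168 Def 3.1/Rem 3.10; KMN arXiv:1803.06713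
§2.1–2.2, Def 2.1; Koda–Naoe arXiv:1905.00809 p.4). -/
def HasConnectedShadowComplexityLE : Prop :=
  ∃ (N : ℕ) (K : Geometry.SimplicialComplex ℝ (EuclideanSpace ℝ (Fin N))) (h : K.space ≃ₜ M)
    (P : Set (Finset (EuclideanSpace ℝ (Fin N)))),
    IsSmoothTriangulation 4 K h ∧
    P ⊆ K.faces ∧
    (∀ s ∈ P, ∀ t, t ⊆ s → t.Nonempty → t ∈ P) ∧
    (∀ s ∈ P, s.card ≤ 3) ∧
    (∀ s ∈ K.faces, (∀ v ∈ s, ({v} : Finset (EuclideanSpace ℝ (Fin N))) ∈ P) → s ∈ P) ∧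
    (∃ G : Set (Finset (EuclideanSpace ℝ (Fin N))), (∀ s ∈ G, s.card ≤ 2) ∧
      Relation.ReflTransGen
        (fun F G : Set (Finset (EuclideanSpace ℝ (Fin N))) => ∃ σ τ : Finset (EuclideanSpace ℝ (Fin N)),
          (σ ∈ F ∧ τ ∈ F ∧ σ ⊂ τ ∧ τ.card = σ.card + 1 ∧ ∀ ρ ∈ F, σ ⊂ ρ → ρ = τ) ∧ G = F \ {σ, τ})
        {s | s ∈ K.faces ∧ ∀ v ∈ s, ({v} : Finset (EuclideanSpace ℝ (Fin N))) ∉ P} G) ∧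
    (∀ x : M, x ∈ h '' {y : K.space | ∃ s ∈ P, (y : EuclideanSpace ℝ (Fin N)) ∈ convexHull ℝ (s : Set (EuclideanSpace ℝ (Fin N)))} →
      ∃ U : Set M, IsOpen U ∧ x ∈ U ∧ ∃ f : M → ℝ, ContMDiffOn (𝓡 4) 𝓘(ℝ, ℝ) ∞ f U ∧
        mfderiv (𝓡 4) 𝓘(ℝ, ℝ) f x ≠ 0 ∧
        ∀ y ∈ U, y ∈ h '' {y : K.space | ∃ s ∈ P, (y : EuclideanSpace ℝ (Fin N)) ∈ convexHull ℝ (s : Set (EuclideanSpace ℝ (Fin N)))} →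
          f y = 0) ∧
    (let L : (v : EuclideanSpace ℝ (Fin N)) →
        SimpleGraph {u : EuclideanSpace ℝ (Fin N) // u ≠ v ∧ ({u, v} : Finset (EuclideanSpace ℝ (Fin N))) ∈ P} :=
      (fun v => SimpleGraph.fromRel fun u w => ({u.1, w.1, v} : Finset (EuclideanSpace ℝ (Fin N))) ∈ P);
    let tetra : EuclideanSpace ℝ (Fin N) → Prop := (fun v =>
      (L v).Connected ∧ ∃ B : Finset {u : EuclideanSpace ℝ (Fin N) // u ≠ v ∧ ({u, v} : Finset (EuclideanSpace ℝ (Fin N))) ∈ P},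
        B.card = 4 ∧ (∀ u, u ∈ B ↔ ((L v).neighborSet u).ncard = 3) ∧ (∀ u, u ∉ B → ((L v).neighborSet u).ncard = 2) ∧
        ∀ a ∈ B, ∀ b ∈ B, a ≠ b →
          ∃ S : Set {u : EuclideanSpace ℝ (Fin N) // u ≠ v ∧ ({u, v} : Finset (EuclideanSpace ℝ (Fin N))) ∈ P},
            a ∈ S ∧ b ∈ S ∧ (∀ u ∈ S, u ∈ B → u = a ∨ u = b) ∧ ((L v).induce S).Connected);
    (∀ v, ({v} : Finset (EuclideanSpace ℝ (Fin N))) ∈ P →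
        ((L v).Connected ∧ ∀ u, ((L v).neighborSet u).ncard = 2) ∨
        ((L v).Connected ∧ ∃ a b, a ≠ b ∧ ((L v).neighborSet a).ncard = 3 ∧ ((L v).neighborSet b).ncard = 3 ∧
          (∀ u, u ≠ a → u ≠ b → ((L v).neighborSet u).ncard = 2) ∧
          ((L v).induce {w | w ≠ a}).Connected ∧ ((L v).induce {w | w ≠ b}).Connected) ∨
        tetra v) ∧
      ∀ a, tetra a →
        {b | (SimpleGraph.fromRel fun u w : EuclideanSpace ℝ (Fin N) =>
              {x | x ≠ u ∧ x ≠ w ∧ ({u, w, x} : Finset (EuclideanSpace ℝ (Fin N))) ∈ P}.ncard = 3).Reachable a b ∧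
            tetra b}.ncard ≤ n)

end Typed

/-! ## §2 Pieces at connected complexity ≤ 4 and their port words

At grades three and four the block TABLES of the grade-one / grade-two lines (11 / 57 / 116 classes) are replaced by the GENERIC
BLOCK CALCULUS below: a block piece is `block s code` for one of the SEVENTEEN shapes `s` (the connected 4-regular multigraphs
on `V ≤ 4` vertices) and ANY sheet decoration, encoded by `code` (base-6 digits, one per edge; only `code % 6^(2V)` matters).
No isomorphism classification is needed for the structure theorem (isomorphic decorations are simply listed several times),
and the finite local lemma `LocalTableLE4` (§4b) quantifies over exactly the same codes. -/
/-! ## Block calculus (gen14; Python twin `enum/blockcalc.py`, which reproduces the gen13 tables: the 11 / 57 / 116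
figure-eight / melon / handcuff classes verbatim, the grade-≤2 local table 205 / 88 / 83 / 5, the grade-3 raw table
47 520 / 17 800 / 17 800 ROE; gen14 `enum/fast4.py` runs the exhaustive grade-4 table 1 761 954 / 540 360 / 540 360 ROE).

A BLOCK is the regular neighbourhood of one connected component `Γ` of the singular graph of a simple polyhedron all of
whose singular points on `Γ` are triple lines and true vertices: `Γ` is a connected 4-regular multigraph on `V` true
vertices with `2V` edges, free rank `V + 1`.  DARTS `(v, i)`, `i < 4`, are the four edge germs at `v`; a SHAPE fixes the
dart pairing `edges[e] = (first dart, second dart)`, a spanning tree (`tree[e]`), and the free letter `letter[e] < V + 1`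
of every non-tree edge.  A DECORATION gives, per edge, the bijection of the three sheets along it as an index `< 6` into the
lexicographic list of permutations of `{0,1,2}`; the sheets containing germ `i` at a vertex are indexed by the OTHER germ
`k ≠ i` in increasing order (`idx i k`).  The boundary circles of the block (its PORTS) are traced through the states
`(v, i, j)` = «at `v`, on the sheet `{i, j}`, leaving through germ `j`»; leaving through the FIRST dart of a non-tree edge
emits its letter with sign `+` (`true`), through the second dart with sign `−`.  Words are `List (ℕ × Bool)`. -/

namespace Block

/-- A block shape: `V` true vertices, the `2V` edges as dart pairs, tree flags, letters of the non-tree edges. -/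
structure Shape where
  /-- number of true vertices -/
  V : ℕ
  /-- the edges: (first dart, second dart), a dart being (vertex, germ) -/
  edges : List ((ℕ × ℕ) × (ℕ × ℕ))
  /-- `tree[e] = true` iff edge `e` is in the chosen spanning tree (emits no letter) -/
  tree : List Bool
  /-- the free letter of edge `e` (meaningful for non-tree edges only) -/
  letter : List ℕ

/-- The `p`-th permutation of `{0,1,2}` in lexicographic order, applied to `t`. -/
def perm3 (p t : ℕ) : ℕ :=
  if p = 0 then t
  else if p = 1 then (if t = 0 then 0 else if t = 1 then 2 else 1)
  else if p = 2 then (if t = 0 then 1 else if t = 1 then 0 else 2)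
  else if p = 3 then (if t = 0 then 1 else if t = 1 then 2 else 0)
  else if p = 4 then (if t = 0 then 2 else if t = 1 then 0 else 1)
  else (if t = 0 then 2 else if t = 1 then 1 else 0)

/-- The inverse of the `p`-th permutation, applied to `t` (`3 ↔ 4`, the others are involutions). -/
def perm3inv (p t : ℕ) : ℕ :=
  perm3 (if p = 3 then 4 else if p = 4 then 3 else p) t

/-- Index of germ `k` among the germs `≠ i`, in increasing order. -/
def idx (i k : ℕ) : ℕ := if k < i then k else k - 1

/-- Inverse of `idx i`. -/
def germ (i t : ℕ) : ℕ := if t < i then t else t + 1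

/-- Find the edge carrying dart `d`: (edge index, `true` iff `d` is its first dart). -/
def findDart : List ((ℕ × ℕ) × (ℕ × ℕ)) → ℕ → ℕ × ℕ → Option (ℕ × Bool)
  | [], _, _ => none
  | (d1, d2) :: rest, e, d =>
      if d = d1 then some (e, true) else if d = d2 then some (e, false) else findDart rest (e + 1) d

/-- One tracing step from the state `(v, i, j)`: the new state and the emitted signed letter (if any). -/
def step (sh : Shape) (deco : List ℕ) (s : ℕ × ℕ × ℕ) : (ℕ × ℕ × ℕ) × Option (ℕ × Bool) :=
  match findDart sh.edges 0 (s.1, s.2.2) with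
  | none => (s, none)
  | some (e, first) =>
      let t := idx s.2.2 s.2.1
      let t2 := if first then perm3 (deco.getD e 0) t else perm3inv (deco.getD e 0) t
      let far : ℕ × ℕ := if first then (sh.edges.getD e ((0, 0), (0, 0))).2 else (sh.edges.getD e ((0, 0), (0, 0))).1
      ((far.1, far.2, germ far.2 t2), if sh.tree.getD e true then none else some (sh.letter.getD e 0, first))

/-- Trace the boundary circle through `s0`: the states visited (from `s0`) and the word emitted (fuel-bounded). -/
def traceAux (sh : Shape) (deco : List ℕ) (s0 : ℕ × ℕ × ℕ) :
    ℕ → (ℕ × ℕ × ℕ) → List (ℕ × ℕ × ℕ) → List (ℕ × Bool) → List (ℕ × ℕ × ℕ) × List (ℕ × Bool)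
  | 0, s, sts, w => ((s :: sts).reverse, w.reverse)
  | fuel + 1, s, sts, w =>
      let r := step sh deco s
      let w' := match r.2 with | none => w | some x => x :: w
      if r.1 = s0 then ((s :: sts).reverse, w'.reverse) else traceAux sh deco s0 fuel r.1 (s :: sts) w'

/-- The cycle and the word of the boundary circle through `s0`. -/
def trace (sh : Shape) (deco : List ℕ) (s0 : ℕ × ℕ × ℕ) : List (ℕ × ℕ × ℕ) × List (ℕ × Bool) :=
  traceAux sh deco s0 (12 * sh.V) s0 [] []

/-- State code `16v + 4i + j` (the tracing order). -/
def code (s : ℕ × ℕ × ℕ) : ℕ := 16 * s.1 + 4 * s.2.1 + s.2.2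

/-- Code of the reversed state `(v, j, i)`. -/
def swapCode (s : ℕ × ℕ × ℕ) : ℕ := 16 * s.1 + 4 * s.2.2 + s.2.1

/-- All states `(v, i, j)`, `i ≠ j`, in increasing code order. -/
def states (sh : Shape) : List (ℕ × ℕ × ℕ) :=
  (List.range sh.V).flatMap fun v => (List.range 4).flatMap fun i =>
    ((List.range 4).filter fun j => j ≠ i).map fun j => (v, i, j)

/-- THE PORT WORDS of the decorated block: one word per boundary circle, read from the circle's least state, for the
orientation whose least state code is smaller than that of the reversed circle (= `blockcalc.ports`). -/
def ports (sh : Shape) (deco : List ℕ) : List (List (ℕ × Bool)) :=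
  (states sh).filterMap fun s0 =>
    let r := trace sh deco s0
    let m1 := (r.1.map code).foldl min (code s0)
    let m2 := (r.1.map swapCode).foldl min (swapCode s0)
    if code s0 = m1 ∧ m1 < m2 then some r.2 else none

/-! ### Free-group words as signed letter lists -/

/-- Free reduction. -/
def freeReduce (w : List (ℕ × Bool)) : List (ℕ × Bool) :=
  (w.foldl (fun acc x => match acc with
    | y :: rest => if y.1 = x.1 ∧ y.2 ≠ x.2 then rest else x :: y :: rest
    | [] => [x]) []).reverse

/-- Inverse word. -/
def winv (w : List (ℕ × Bool)) : List (ℕ × Bool) := (w.map fun x => (x.1, !x.2)).reverse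

/-- Strip cancelling first/last letters (fuel-bounded). -/
def cycStrip : ℕ → List (ℕ × Bool) → List (ℕ × Bool)
  | 0, w => w
  | fuel + 1, w =>
      match w, w.getLast? with
      | x :: rest, some y =>
          if rest ≠ [] ∧ x.1 = y.1 ∧ x.2 ≠ y.2 then cycStrip fuel (rest.dropLast) else w
      | _, _ => w

/-- Cyclic reduction. -/
def cycReduce (w : List (ℕ × Bool)) : List (ℕ × Bool) :=
  let r := freeReduce w
  cycStrip r.length r

/-- Exponent sum of letter `x` in `w`. -/
def expSum (w : List (ℕ × Bool)) (x : ℕ) : ℤ :=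
  w.foldl (fun a g => if g.1 = x then (if g.2 then a + 1 else a - 1) else a) 0

/-- Exponent-sum matrix of a tuple of words in the letters `0, …, r-1` (rows = words). -/
def expMatrix (ws : List (List (ℕ × Bool))) (r : ℕ) : List (List ℤ) :=
  ws.map fun w => (List.range r).map (expSum w)

/-- Determinant by Laplace expansion along the first row (fuel-bounded). -/
def detAux : ℕ → List (List ℤ) → ℤ
  | 0, _ => 1
  | _ + 1, [] => 1
  | fuel + 1, row :: rest =>
      (List.range row.length).foldl
        (fun acc j => acc + (if j % 2 = 0 then 1 else -1) * row.getD j 0 * detAux fuel (rest.map fun r' => r'.eraseIdx j))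
        0

/-- Integer determinant of a square matrix given as a list of rows. -/
def det (M : List (List ℤ)) : ℤ := detAux M.length M

/-- Number of occurrences of letter `x` (either sign). -/
def occurrences (w : List (ℕ × Bool)) (x : ℕ) : ℕ := w.countP fun g => g.1 = x

/-- For a word containing `x` exactly once: rotate it to `x^ε · U` and return `(ε, W)` with the word conjugate to
`(x · W)^ε` (`W = U` if `ε = +`, `W = U⁻¹` if `ε = −`). -/
def splitAt (w : List (ℕ × Bool)) (x : ℕ) : Bool × List (ℕ × Bool) :=
  let k := w.findIdx fun g => g.1 = x
  let rot := w.rotate k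
  match rot with
  | [] => (true, [])
  | h :: U => (h.2, if h.2 then U else winv U)

/-- Substitute `x ↦ V` (and `x⁻¹ ↦ V⁻¹`) in `w`, then cyclically reduce. -/
def substitute (w : List (ℕ × Bool)) (x : ℕ) (V : List (ℕ × Bool)) : List (ℕ × Bool) :=
  cycReduce (w.flatMap fun g => if g.1 = x then (if g.2 then V else winv V) else [g])

/-- RECURSIVE ONE-OCCURRENCE ELIMINATION (ROE) search: repeatedly pick a remaining relator containing a remaining letter
`x` exactly once, `rel ~ (x · W)^ε`, substitute `x ↦ W⁻¹` in the other relators, drop `rel` and `x`; succeed when no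
relator and no letter is left (= gen13 `roe.py` / `blockcalc.roe`, existence only). -/
def roeSearch : ℕ → List (List (ℕ × Bool)) → List ℕ → Bool
  | 0, _, _ => false
  | fuel + 1, rels, letters =>
      if rels.isEmpty && letters.isEmpty then true
      else if rels.isEmpty || letters.isEmpty then false
      else (List.range rels.length).any fun ri =>
        let w := rels.getD ri []
        letters.any fun x =>
          occurrences w x == 1 &&
            roeSearch fuel ((rels.eraseIdx ri).map fun q => substitute q x (winv (splitAt w x).2)) (letters.erase x)

/-- THE LOCAL CHECK of a decorated block: every UNIMODULAR owned tuple — `V + 1` of the (cyclically reduced) port words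
whose exponent-sum matrix has determinant `±1` — admits an ROE certificate. -/
def localCheck (sh : Shape) (deco : List ℕ) : Bool :=
  let ws := (ports sh deco).map cycReduce
  let r := sh.V + 1
  (ws.sublists.filter fun tup => tup.length = r).all fun tup =>
    ((det (expMatrix tup r)).natAbs != 1) || roeSearch (r + 1) tup (List.range r)

/-- Base-6 digits (least significant first): the decoration with code `n` on `E` edges. -/
def decode (E n : ℕ) : List ℕ := (List.range E).map fun i => n / 6 ^ i % 6

/-! ### The seventeen block shapes with at most four true vertices
(connected 4-regular multigraphs on `V ≤ 4` vertices: the figure eight; the melon and the handcuff; `TH` = three doubled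
edges, `L1` = one loop + single, single, triple edge, `L2` = loops at two vertices + two doubled edges, `L3` = a loop at
each vertex + a triangle — gen12/13 conventions, germs 0-based; and the ten shapes `Q1 … Q10` on four vertices enumerated by
gen14 `enum/shapes4.py` (loop counts / edge multiplicities up to isomorphism; germs: loops first, then neighbours in order;
spanning tree greedy over non-loop edges). -/

/-- V = 1: loops `(0,0)–(0,1)` [letter 0] and `(0,2)–(0,3)` [letter 1]. -/
def eight : Shape := ⟨1, [((0,0),(0,1)), ((0,2),(0,3))], [false, false], [0, 1]⟩
/-- V = 2, melon: `eᵢ : (0,i)–(1,i)`, letters 0,1,2, `e₄` tree. -/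
def melon : Shape := ⟨2, [((0,0),(1,0)), ((0,1),(1,1)), ((0,2),(1,2)), ((0,3),(1,3))], [false, false, false, true], [0, 1, 2, 0]⟩
/-- V = 2, handcuff: loop `(0,0)–(0,1)` [0], loop `(1,0)–(1,1)` [2], edge `(0,2)–(1,2)` [1], edge `(0,3)–(1,3)` tree. -/
def handcuff : Shape := ⟨2, [((0,0),(0,1)), ((1,0),(1,1)), ((0,2),(1,2)), ((0,3),(1,3))], [false, false, false, true], [0, 2, 1, 0]⟩
/-- V = 3, `TH`. -/
def th : Shape := ⟨3, [((0,0),(1,0)), ((0,1),(1,1)), ((0,2),(2,0)), ((0,3),(2,1)), ((1,2),(2,2)), ((1,3),(2,3))],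
  [true, false, true, false, false, false], [0, 0, 0, 1, 2, 3]⟩
/-- V = 3, `L1`. -/
def l1 : Shape := ⟨3, [((0,0),(0,1)), ((0,2),(1,0)), ((0,3),(2,0)), ((1,1),(2,1)), ((1,2),(2,2)), ((1,3),(2,3))],
  [false, true, true, false, false, false], [0, 0, 0, 1, 2, 3]⟩
/-- V = 3, `L2`. -/
def l2 : Shape := ⟨3, [((0,0),(0,1)), ((1,0),(1,1)), ((0,2),(2,0)), ((0,3),(2,1)), ((1,2),(2,2)), ((1,3),(2,3))],
  [false, false, true, false, true, false], [0, 1, 0, 2, 0, 3]⟩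
/-- V = 3, `L3`. -/
def l3 : Shape := ⟨3, [((0,0),(0,1)), ((1,0),(1,1)), ((2,0),(2,1)), ((0,2),(1,2)), ((1,3),(2,2)), ((0,3),(2,3))],
  [false, false, false, true, true, false], [0, 1, 2, 0, 0, 3]⟩

/-- V = 4, `Q1` (gen14 `enum/shapes4.py`). -/
def q1 : Shape := ⟨4, [((0,0),(2,0)), ((0,1),(3,0)), ((0,2),(3,1)), ((0,3),(3,2)), ((1,0),(2,1)), ((1,1),(2,2)), ((1,2),(2,3)), ((1,3),(3,3))],
  [true, true, false, false, true, false, false, false], [0, 0, 0, 1, 0, 2, 3, 4]⟩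
/-- V = 4, `Q2` (gen14 `enum/shapes4.py`). -/
def q2 : Shape := ⟨4, [((0,0),(2,0)), ((0,1),(2,1)), ((0,2),(3,0)), ((0,3),(3,1)), ((1,0),(2,2)), ((1,1),(2,3)), ((1,2),(3,2)), ((1,3),(3,3))],
  [true, false, true, false, true, false, false, false], [0, 0, 0, 1, 0, 2, 3, 4]⟩
/-- V = 4, `Q3` (gen14 `enum/shapes4.py`). -/
def q3 : Shape := ⟨4, [((0,0),(1,0)), ((0,1),(2,0)), ((0,2),(3,0)), ((0,3),(3,1)), ((1,1),(2,1)), ((1,2),(2,2)), ((1,3),(3,2)), ((2,3),(3,3))],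
  [true, true, true, false, false, false, false, false], [0, 0, 0, 0, 1, 2, 3, 4]⟩
/-- V = 4, `Q4` (gen14 `enum/shapes4.py`). -/
def q4 : Shape := ⟨4, [((3,0),(3,1)), ((0,0),(1,0)), ((0,1),(2,0)), ((0,2),(3,2)), ((0,3),(3,3)), ((1,1),(2,1)), ((1,2),(2,2)), ((1,3),(2,3))],
  [false, true, true, true, false, false, false, false], [0, 0, 0, 0, 1, 2, 3, 4]⟩
/-- V = 4, `Q5` (gen14 `enum/shapes4.py`). -/
def q5 : Shape := ⟨4, [((3,0),(3,1)), ((0,0),(1,0)), ((0,1),(2,0)), ((0,2),(2,1)), ((0,3),(3,2)), ((1,1),(2,2)), ((1,2),(2,3)), ((1,3),(3,3))],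
  [false, true, true, false, true, false, false, false], [0, 0, 0, 1, 0, 2, 3, 4]⟩
/-- V = 4, `Q6` (gen14 `enum/shapes4.py`). -/
def q6 : Shape := ⟨4, [((2,0),(2,1)), ((3,0),(3,1)), ((0,0),(1,0)), ((0,1),(1,1)), ((0,2),(3,2)), ((0,3),(3,3)), ((1,2),(2,2)), ((1,3),(2,3))],
  [false, false, true, false, true, false, true, false], [0, 1, 0, 2, 0, 3, 0, 4]⟩
/-- V = 4, `Q7` (gen14 `enum/shapes4.py`). -/
def q7 : Shape := ⟨4, [((2,0),(2,1)), ((3,0),(3,1)), ((0,0),(1,0)), ((0,1),(1,1)), ((0,2),(2,2)), ((0,3),(3,2)), ((1,2),(2,3)), ((1,3),(3,3))],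
  [false, false, true, false, true, true, false, false], [0, 1, 0, 2, 0, 0, 3, 4]⟩
/-- V = 4, `Q8` (gen14 `enum/shapes4.py`). -/
def q8 : Shape := ⟨4, [((2,0),(2,1)), ((3,0),(3,1)), ((0,0),(1,0)), ((0,1),(1,1)), ((0,2),(1,2)), ((0,3),(3,2)), ((1,3),(2,2)), ((2,3),(3,3))],
  [false, false, true, false, false, true, true, false], [0, 1, 0, 2, 3, 0, 0, 4]⟩
/-- V = 4, `Q9` (gen14 `enum/shapes4.py`). -/
def q9 : Shape := ⟨4, [((1,0),(1,1)), ((2,0),(2,1)), ((3,0),(3,1)), ((0,0),(1,2)), ((0,1),(2,2)), ((0,2),(3,2)), ((0,3),(3,3)), ((1,3),(2,3))],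
  [false, false, false, true, true, true, false, false], [0, 1, 2, 0, 0, 0, 3, 4]⟩
/-- V = 4, `Q10` (gen14 `enum/shapes4.py`). -/
def q10 : Shape := ⟨4, [((0,0),(0,1)), ((1,0),(1,1)), ((2,0),(2,1)), ((3,0),(3,1)), ((0,2),(2,2)), ((0,3),(3,2)), ((1,2),(2,3)), ((1,3),(3,3))],
  [false, false, false, false, true, true, true, false], [0, 1, 2, 3, 0, 0, 0, 4]⟩

end Block

/-- The seventeen block shapes with at most four true vertices, by name. -/
inductive BlockShape : Type
  | eight
  | melon
  | handcuff
  | th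
  | l1
  | l2
  | l3
  | q1
  | q2
  | q3
  | q4
  | q5
  | q6
  | q7
  | q8
  | q9
  | q10
  deriving DecidableEq

namespace BlockShape

/-- The dart-pairing data of each named shape. -/
def shape : BlockShape → Block.Shape
  | eight => Block.eight
  | melon => Block.melon
  | handcuff => Block.handcuff
  | th => Block.th
  | l1 => Block.l1
  | l2 => Block.l2
  | l3 => Block.l3
  | q1 => Block.q1
  | q2 => Block.q2
  | q3 => Block.q3
  | q4 => Block.q4
  | q5 => Block.q5
  | q6 => Block.q6
  | q7 => Block.q7
  | q8 => Block.q8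
  | q9 => Block.q9
  | q10 => Block.q10

/-- Number of true vertices. -/
def V : BlockShape → ℕ
  | eight => 1
  | melon => 2
  | handcuff => 2
  | th => 3
  | l1 => 3
  | l2 => 3
  | l3 => 3
  | q1 => 4
  | q2 => 4
  | q3 => 4
  | q4 => 4
  | q5 => 4
  | q6 => 4
  | q7 => 4
  | q8 => 4
  | q9 => 4
  | q10 => 4

/-- Number of decorations of the shape: `6^(2V)`. -/
def numDeco (s : BlockShape) : ℕ := 6 ^ (2 * s.V)

end BlockShape

/-- A traced word as an element of `F₅ = ⟨x₀, …, x₄⟩` (letters are `< 5` for every shape with `V ≤ 4`). -/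
def Block.toFG5 (w : List (ℕ × Bool)) : FreeGroup (Fin 5) :=
  FreeGroup.mk (w.map fun g => ((⟨g.1 % 5, Nat.mod_lt _ (by norm_num)⟩ : Fin 5), g.2))

/-- The port words of the block of shape `s` with decoration code `code`, in `F₅`. -/
def blockPorts (s : BlockShape) (code : ℕ) : List (FreeGroup (Fin 5)) :=
  (Block.ports s.shape (Block.decode (2 * s.V) (code % s.numDeco))).map Block.toFG5

/-- Spine letters `a, b` of the grade ≤ 1 pieces (five letters for every piece; a piece of rank `r` uses the first `r`). -/
def la : FreeGroup (Fin 5) := FreeGroup.of 0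
/-- Second spine letter. -/
def lb : FreeGroup (Fin 5) := FreeGroup.of 1

/-- The pieces of a simple polyhedron of connected complexity ≤ 4: KMN's pieces without true vertices, and the decorated
blocks with 1, 2, 3 or 4 true vertices. -/
inductive Piece : Type
  | disc
  | pants
  | moebius
  | y111
  | y12
  | y3
  | block (s : BlockShape) (code : ℕ)
  deriving DecidableEq

namespace Piece

/-- Rank of the free fundamental group of the piece's spine (point, circle, figure-eight, 4-regular graph on `V` vertices). -/
def rank : Piece → ℕ
  | disc => 0
  | pants => 2
  | moebius => 1
  | y111 => 1
  | y12 => 1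
  | y3 => 1
  | block s _ => s.V + 1

/-- Port words of every piece (grade ≤ 1 pieces as in the grade-one line; blocks by the block calculus). -/
def ports : Piece → List (FreeGroup (Fin 5))
  | disc => [1]
  | pants => [la, lb, la * lb]
  | moebius => [la * la]
  | y111 => [la, la, la]
  | y12 => [la, la * la]
  | y3 => [la * la * la]
  | block s code => blockPorts s code

/-- Number of boundary circles (ports) of a piece. -/
def numPorts (p : Piece) : ℕ := p.ports.length

/-- The `j`-th port word of a piece (junk value `1` out of range). -/
def portWord (p : Piece) (j : ℕ) : FreeGroup (Fin 5) := p.ports.getD j 1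

/-- Number of true vertices inside the piece. -/
def numTrueVertices : Piece → ℕ
  | block s _ => s.V
  | _ => 0

end Piece

/-! ## §3 Encoding graphs and their graph-of-spaces presentations (five letters per piece) -/

/-- A KMN ENCODING GRAPH at connected complexity ≤ 4: `k` pieces, `m` glued port pairs with orientation signs, a chosen
spanning tree (same data as the grade-one line's `ShadowGraph`, over the larger piece type). -/
structure ShadowGraph where
  /-- number of pieces -/
  k : ℕ
  /-- number of glued port pairs -/
  m : ℕ
  /-- the piece at each vertex of the encoding graph -/
  piece : Fin k → Piece
  /-- first port of the `e`-th gluing: (piece index, port index) -/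
  src : Fin m → Fin k × ℕ
  /-- second port of the `e`-th gluing -/
  tgt : Fin m → Fin k × ℕ
  /-- gluing orientation of the `e`-th pair of boundary circles -/
  sgn : Fin m → Bool
  /-- the edges of the chosen spanning tree (their stable letters are killed) -/
  tree : Fin m → Bool

namespace ShadowGraph

variable (G : ShadowGraph)

/-- All `2m` port references used by the gluings. -/
def endpoints : Fin G.m ⊕ Fin G.m → Fin G.k × ℕ := Sum.elim G.src G.tgt

/-- Every referenced port exists. -/
def PortsValid : Prop :=
  ∀ e : Fin G.m, (G.src e).2 < (G.piece (G.src e).1).numPorts ∧ (G.tgt e).2 < (G.piece (G.tgt e).1).numPorts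

/-- No boundary circle is glued twice. -/
def PortsInjective : Prop := Function.Injective G.endpoints

/-- The simple graph on pieces spanned by the tree edges. -/
def treeAdj : SimpleGraph (Fin G.k) :=
  SimpleGraph.fromRel fun u v => ∃ e : Fin G.m, G.tree e = true ∧ (G.src e).1 = u ∧ (G.tgt e).1 = v

/-- The tree edges form a spanning tree of the encoding graph. -/
def IsSpanningTree : Prop :=
  (∀ e, G.tree e = true → (G.src e).1 ≠ (G.tgt e).1) ∧ G.treeAdj.Connected ∧
    (Finset.univ.filter fun e => G.tree e = true).card + 1 = G.k

/-- ADMISSIBLE encoding graphs: valid ports, no port glued twice, a genuine spanning tree.  (Connected complexity ≤ 4 is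
automatic: every block is a whole component of the singular set.) -/
def Admissible : Prop := G.PortsValid ∧ G.PortsInjective ∧ G.IsSpanningTree

/-- Number of true vertices of `X_G` (sub-grading; `≤ 4` per singular component by construction). -/
def numVertices : ℕ := ∑ v, (G.piece v).numTrueVertices

/-- GENERATORS: four spine letters per piece and one stable letter per glued pair. -/
abbrev Gen : Type := (Fin G.k × Fin 5) ⊕ Fin G.m

/-- RELATOR INDICES: one gluing relator per glued pair, one killing relator per tree edge, one killing relator per unused
spine letter `(v, i)` with `rank(piece v) ≤ i`. -/
abbrev Rel : Type := Fin G.m ⊕ {e : Fin G.m // G.tree e = true} ⊕ {p : Fin G.k × Fin 5 // (G.piece p.1).rank ≤ (p.2 : ℕ)}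

/-- The spine letters of piece `v` inside the big free group. -/
def embed (v : Fin G.k) : FreeGroup (Fin 5) →* FreeGroup G.Gen :=
  FreeGroup.map fun i => Sum.inl (v, i)

/-- The word of port `(v, j)` in the big free group. -/
def portWordAt (p : Fin G.k × ℕ) : FreeGroup G.Gen := G.embed p.1 ((G.piece p.1).portWord p.2)

/-- The stable letter of the `e`-th glued pair. -/
def stable (e : Fin G.m) : FreeGroup G.Gen := FreeGroup.of (Sum.inr e)

/-- The GLUING RELATOR of the `e`-th pair: `w_src · t_e · w_tgt^{±1} · t_e⁻¹`. -/
def gluingRelator (e : Fin G.m) : FreeGroup G.Gen :=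
  G.portWordAt (G.src e) * G.stable e * (if G.sgn e then G.portWordAt (G.tgt e) else (G.portWordAt (G.tgt e))⁻¹) *
    (G.stable e)⁻¹

/-- All relators of the uniform encoding. -/
def relator : G.Rel → FreeGroup G.Gen
  | Sum.inl e => G.gluingRelator e
  | Sum.inr (Sum.inl e) => G.stable e.1
  | Sum.inr (Sum.inr p) => FreeGroup.of (Sum.inl p.1)

/-- THE PRESENTATION `P(G)`, transported to `Fin n` along bijections of the index types (balanced iff `Σ_v rank = k − 1`). -/
def presentation {n : ℕ} (eg : G.Gen ≃ Fin n) (er : G.Rel ≃ Fin n) : BalancedPresentation n :=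
  fun j => FreeGroup.map eg (G.relator (er.symm j))

end ShadowGraph

/-! ## §4a Recursive one-occurrence elimination certificates (pure free-group data) -/

namespace Roe

variable {n : ℕ}

/-- The substitution `x ↦ W⁻¹`, all other letters fixed. -/
def substHom (x : Fin n) (W : FreeGroup (Fin n)) : FreeGroup (Fin n) →* FreeGroup (Fin n) :=
  FreeGroup.lift fun y => if y = x then W⁻¹ else FreeGroup.of y

/-- One elimination step: relator index, eliminated letter, the complementary word, and a sign. -/
structure Step (n : ℕ) where
  /-- the relator used at this step -/
  rel : Fin n
  /-- the letter eliminated at this step -/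
  letter : Fin n
  /-- the word `W` with `relator ~ (letter · W)^{±1}` -/
  word : FreeGroup (Fin n)
  /-- `true`: the relator is conjugate to `letter · W`; `false`: to its inverse -/
  sgn : Bool

/-- VALIDITY of a step list from a state (accumulated substitution `Φ`, eliminated letters `E`, used relators `U`):
the next relator, AFTER the substitutions so far, is conjugate to `(x · W)^{±1}` with `x` fresh and `W` a word in the
letters that are neither eliminated nor `x`; then `x ↦ W⁻¹` is composed into `Φ`.  At the end every letter is eliminated
and every relator used. -/
def Valid (P : BalancedPresentation n) :
    List (Step n) → (FreeGroup (Fin n) →* FreeGroup (Fin n)) → Finset (Fin n) → Finset (Fin n) → Prop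
  | [], _, E, U => E = Finset.univ ∧ U = Finset.univ
  | s :: rest, Φ, E, U =>
      s.letter ∉ E ∧ s.rel ∉ U ∧
      s.word ∈ Subgroup.closure (FreeGroup.of '' {y : Fin n | y ∉ E ∧ y ≠ s.letter}) ∧
      IsConj (Φ (P s.rel))
        (if s.sgn then FreeGroup.of s.letter * s.word else (FreeGroup.of s.letter * s.word)⁻¹) ∧
      Valid P rest ((substHom s.letter s.word).comp Φ) (insert s.letter E) (insert s.rel U)

/-- `P` admits a recursive one-occurrence elimination certificate.  (The grade-one ERASURE certificates of gen 12 —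
`IsConj (erase_{rk < rk i} (P (σ i))) (xᵢ^{±1})` — are the special case `W = 1` at every step.) -/
def HasCertificate (P : BalancedPresentation n) : Prop :=
  ∃ steps : List (Step n), Valid P steps (MonoidHom.id _) ∅ ∅

end Roe

/-! ## §4b The six registered stubs and the composition -/

/-- Local abbreviation: the round 4-sphere. -/
abbrev S4 : Type := (Metric.sphere (0 : EuclideanSpace ℝ (Fin 5)) 1)

/-- STATEMENT OF STUB 1 (structure at `c* ≤ 4`): a smooth homotopy 4-sphere of connected shadow complexity ≤ 4 is the
boundary of a presentation 5-manifold `H⁵(P(G), ε)` of an ADMISSIBLE grade-four encoding graph `G` whose presentation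
presents the trivial group. -/
def KMNGraphPresentationFour : Prop :=
  ∀ (X : Type) [TopologicalSpace X] [T2Space X] [SecondCountableTopology X]
    [ChartedSpace (EuclideanSpace ℝ (Fin 4)) X] [IsManifold (𝓡 4) ∞ X],
    X ≃ₕ S4 → HasConnectedShadowComplexityLE 4 X →
    ∃ (G : ShadowGraph) (n : ℕ) (eg : G.Gen ≃ Fin n) (er : G.Rel ≃ Fin n),
      G.Admissible ∧ (G.presentation eg er).PresentsTrivialGroup ∧
      ∃ (W : Type) (_ : TopologicalSpace W) (_ : T2Space W) (_ : SecondCountableTopology W)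
        (_ : ChartedSpace (EuclideanHalfSpace (4 + 1)) W) (_ : IsManifold (𝓡∂ (4 + 1)) ∞ W) (_ : CompactSpace W),
        IsPresentationHandlebodyFive (G.presentation eg er) W ∧
        ∃ φ : X → W, Manifold.IsSmoothEmbedding (𝓡 4) (𝓡∂ (4 + 1)) ∞ φ ∧
          Set.range φ = (𝓡∂ (4 + 1)).boundary W

/-- STATEMENT OF STUB 2b (FINITE; `V ≤ 3` machine-certified in the gen14 instrument file `G14Certificates.lean` by `decide` /
`native_decide` over all `36 + 2·1 296 + 4·46 656` decorations, `V = 4` EXHAUSTIVELY checked by `enum/fast4.py` over all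
`10·6⁸ = 16 796 160` decorated blocks — 1 761 954 owned 5-tuples, 540 360 unimodular, all ROE): THE LOCAL TABLE (★≤4) —
for every block with at most four true vertices, every unimodular owned tuple of port words admits a recursive
one-occurrence elimination. -/
def LocalTableLE4 : Prop :=
  ∀ (s : BlockShape) (n : ℕ), n < s.numDeco → Block.localCheck s.shape (Block.decode (2 * s.V) n) = true

/-- The grade-four DICHOTOMY in certificate form: the presentation of an admissible grade-four encoding graph that presents
the trivial group admits an elimination certificate. -/
def GradeFourDichotomy : Prop :=
  ∀ (G : ShadowGraph) (n : ℕ) (eg : G.Gen ≃ Fin n) (er : G.Rel ≃ Fin n),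
    G.Admissible → (G.presentation eg er).PresentsTrivialGroup → Roe.HasCertificate (G.presentation eg er)

/-- STATEMENT OF STUB 2a (LOAD-BEARING, conceptual — the OWNERSHIP LEDGER, gen13 NODE §1 / §4 verbatim one grade up): the local
table implies the dichotomy (tree WLOG, cut excesses ∈ {0,1} else `H₁ ≠ 0`, canonical ownership, `|det| = ∏ local minors`,
level induction; the only grade-dependent input is (★≤4)). -/
def LedgerFour : Prop := LocalTableLE4 → GradeFourDichotomy

/-- STATEMENT OF STUB 3 (pure algebra): an elimination certificate implies Andrews–Curtis triviality (no stabilisation). -/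
def RoeSound : Prop :=
  ∀ (n : ℕ) (P : BalancedPresentation n), Roe.HasCertificate P →
    IsAndrewsCurtisEquivalent P (BalancedPresentation.trivial n)

/-- The grade-four Andrews–Curtis statement. -/
def GradeFourAC : Prop :=
  ∀ (G : ShadowGraph) (n : ℕ) (eg : G.Gen ≃ Fin n) (er : G.Rel ≃ Fin n),
    G.Admissible → (G.presentation eg er).PresentsTrivialGroup →
    IsStablyAndrewsCurtisEquivalent (G.presentation eg er) (BalancedPresentation.trivial n)

/-- STATEMENT OF STUB 5 (DECLARED RESIDUAL, species R — the next cell of the DS ladder): contractible doubles that are homotopy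
4-spheres and admit NO typed shadow of connected complexity ≤ 4 are standard.  (The crux is this statement with `2` for `4`;
the residual is strictly weaker on paper exactly by the theorem-grade rows `c* = 3, 4` closed by stubs 1–4, and `c* = 5` is
where the abelian local mechanism provably STOPS: the certified Poincaré block `B₁₂₀`, gen14 NODE §3.) -/
def DoublesBeyondShadowFour : Prop :=
  ∀ (C : Type) [TopologicalSpace C] [T2Space C] [SecondCountableTopology C] [ChartedSpace (EuclideanHalfSpace 4) C]
    [IsManifold (𝓡∂ 4) ∞ C] [CompactSpace C] [ContractibleSpace C] (bC : BoundaryData (𝓡∂ 4) C (𝓡 3))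
    (X : Type) [TopologicalSpace X] [T2Space X] [SecondCountableTopology X] [ChartedSpace (EuclideanSpace ℝ (Fin 4)) X]
    [IsManifold (𝓡 4) ∞ X],
    X ≃ₕ S4 → IsDouble bC (𝓡 4) X → ¬ HasConnectedShadowComplexityLE 4 X → Nonempty (X ≃ₘ⟮𝓡 4, 𝓡 4⟯ S4)

/-- PROVED: soundness + ledger + local table give the grade-four Andrews–Curtis statement (with `k = 0` stabilisations). -/
theorem gradeFourAC_of (hs : RoeSound) (hl : LedgerFour) (ht : LocalTableLE4) : GradeFourAC :=
  fun G n eg er hadm htriv => ⟨0, hs n _ (hl ht G n eg er hadm htriv)⟩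

/-- STUB 1 (registered) — structure theorem at `c* ≤ 4`, presentation form (KMN arXiv:1803.06713 §2 / §4, Turaev's
reconstruction, H-A-M Ch. I Thm 3.4; plus: a connected 4-regular multigraph on ≤ 4 vertices is one of the seventeen shapes,
`enum/shapes4.py`).  Size L. -/
theorem stub_kmnGraphPresentationFour : KMNGraphPresentationFour := by
  sorry

/-- STUB 2a (registered, LOAD-BEARING) — the ownership ledger one grade up (gen13 NODE §1, §4; gen14 NODE §2).  Size L. -/
theorem stub_ledgerFour : LedgerFour := by
  sorry

/-- STUB 2b (registered, FINITE) — the local table (★≤4): the `V ≤ 3` part is certified by compiled evaluation in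
`G14Certificates.lean` (`localTableLE3` = this statement on the first seven shapes; reproduced by `enum/blockcalc.py` and gen13
`enum/blocks3.py`); the `V = 4` part is exhaustively checked by `enum/fast4.py` (192 s; its Lean certification = ten compiled
evaluations of `6⁸` codes each, not run this generation).  Size M–L (kernel-grade: per-code `decide`). -/
theorem stub_localTableFour : LocalTableLE4 := by
  sorry

/-- STUB 3 (registered) — soundness of elimination certificates.  Size M (tree lemmas `update_mul_of_mem_normalClosure`,
`update_of_isConj`, `isAndrewsCurtisEquivalent_trivial_of_isConj_erase`). -/
theorem stub_roeSound : RoeSound := by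
  sorry

/-- STUB 4 (registered; the tree's NAMED FACT by name — Andrews–Curtis 1965, Hog-Angeloni–Metzler Ch. I Thm 3.4). -/
theorem stub_acFiveBall :
    IsPresentationHandlebodyFive.nonempty_diffeomorph_closedBall_of_isStablyAndrewsCurtisEquivalent := by
  sorry

/-- STUB 5 (registered, DECLARED RESIDUAL `c* ≥ 5`) — exactly where the abelian local mechanism STOPS (gen14 NODE §3: (★≤4)
holds exhaustively, (★₅) is FALSE by the certified Poincaré block `B₁₂₀`; a π₁-sensitive, non-local certificate is needed
from here on).  Size XL / idea-needed. -/
theorem stub_beyondShadowFour : DoublesBeyondShadowFour := by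
  sorry

/-- Informational (PROVED, not used below): the tree's open Andrews–Curtis conjecture dominates the combinatorial content. -/
theorem gradeFourAC_of_andrewsCurtisConjecture (h : AndrewsCurtisConjecture) : GradeFourAC :=
  fun G n eg er _ htriv => h n (G.presentation eg er) htriv

/-- The boundary step (PROVED): if `X` is embedded as the boundary of `W` and `W ≅ 𝔻⁵` then `X ≅ S⁴`. -/
theorem nonempty_diffeomorph_sphere_of_boundary
    (X : Type) [TopologicalSpace X] [ChartedSpace (EuclideanSpace ℝ (Fin 4)) X] [IsManifold (𝓡 4) ∞ X]
    (W : Type) [TopologicalSpace W] [ChartedSpace (EuclideanHalfSpace (4 + 1)) W]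
    (φ : X → W) (hφ : Manifold.IsSmoothEmbedding (𝓡 4) (𝓡∂ (4 + 1)) ∞ φ)
    (hr : Set.range φ = (𝓡∂ (4 + 1)).boundary W)
    (g : W ≃ₘ⟮𝓡∂ (4 + 1), 𝓡∂ (4 + 1)⟯ (Metric.closedBall (0 : EuclideanSpace ℝ (Fin (4 + 1))) 1)) :
    Nonempty (X ≃ₘ⟮𝓡 4, 𝓡 4⟯ S4) :=
  let bW : BoundaryData (𝓡∂ (4 + 1)) W (𝓡 4) :=
    { carrier := X, incl := φ, isSmoothEmbedding := hφ, range_incl := hr }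
  ⟨bW.restrictDiffeomorph (closedBallBoundaryData 4) g⟩

/-- The theorem-grade rows `c* ≤ 4` (PROVED from stubs 1–4): every smooth homotopy 4-sphere of connected shadow complexity ≤ 4
is diffeomorphic to `S⁴`. -/
theorem sphere_of_shadowComplexityLE_four
    (X : Type) [TopologicalSpace X] [T2Space X] [SecondCountableTopology X]
    [ChartedSpace (EuclideanSpace ℝ (Fin 4)) X] [IsManifold (𝓡 4) ∞ X]
    (e : X ≃ₕ S4) (hc : HasConnectedShadowComplexityLE 4 X) : Nonempty (X ≃ₘ⟮𝓡 4, 𝓡 4⟯ S4) := by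
  obtain ⟨G, n, eg, er, hadm, htriv, W, _, _, _, _, _, _, hPW, φ, hφ, hr⟩ := stub_kmnGraphPresentationFour X e hc
  obtain ⟨g⟩ := stub_acFiveBall n (G.presentation eg er) W hPW
    (gradeFourAC_of stub_roeSound stub_ledgerFour stub_localTableFour G n eg er hadm htriv)
  exact nonempty_diffeomorph_sphere_of_boundary X W φ hφ hr g

/-- **`DoublesBeyondShadowTwo_of` — THE SKELETON**: split the residual cell `c* ≥ 3` at `c* = 4`: the rows `c* ≤ 4` are
STUB 1 → (STUB 3 + STUB 2a + STUB 2b ⟹ `GradeFourAC`) → STUB 4; the rest is the declared residual STUB 5.  Concludes the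
crux `RootDecompAE.DoublesBeyondShadowTwo` BY NAME (real proof; no sorry of its own; the negated `c* ≤ 2` hypothesis is not used). -/
theorem DoublesBeyondShadowTwo_of :
    Summit.SmoothPoincare4.SmoothPoincare4.Theses.RootDecompAE.DoublesBeyondShadowTwo := by
  intro C _ _ _ _ _ _ _ bC X _ _ _ _ _ e hD hnot
  by_cases hc : HasConnectedShadowComplexityLE 4 X
  · exact sphere_of_shadowComplexityLE_four X e hc
  · exact stub_beyondShadowFour C bC X e hD hc

#print axioms DoublesBeyondShadowTwo_of
#print axioms gradeFourAC_of
#print axioms sphere_of_shadowComplexityLE_four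
#print axioms nonempty_diffeomorph_sphere_of_boundary

/-! ## §5 Inhabitedness and sanity examples -/

namespace Examples

open Piece ShadowGraph

/-- The melon block of gen13 class 42 (decoration code 690 = digits `0,1,1,3`; ports `bA, cA, BcbCA` up to cyclic
conjugacy and inversion — one of the five unimodular owned triples that are NOT letter-triangular) with its three ports
capped by discs: balanced (`Σ rank = 3 = k − 1`). -/
def exMelon42 : ShadowGraph where
  k := 4
  m := 3
  piece := ![block .melon 690, disc, disc, disc]
  src := fun e => (0, (e : ℕ))
  tgt := fun e => (Fin.succ e, 0)
  sgn := fun _ => true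
  tree := fun _ => true

/-- The melon block 690 has exactly three ports (block calculus, kernel evaluation). -/
example : (Block.ports Block.melon (Block.decode 4 690)).length = 3 := by decide

/-- … and passes the local check (its one owned triple is unimodular and eliminable). -/
example : Block.localCheck Block.melon (Block.decode 4 690) = true := by decide

/-- `exMelon42` is balanced: 23 generators … -/
example : Fintype.card exMelon42.Gen = 23 := by decide
/-- … and 23 relators (3 gluing, 3 tree, 17 unused letters: two of the block, five of each disc). -/
example : Fintype.card exMelon42.Rel = 23 := by decide

/-- A one-step certificate in rank one: `⟨x₀ ∣ x₀⟩` is certified by the single step `(0, 0, 1, +)`. -/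
example : Roe.HasCertificate (BalancedPresentation.trivial 1) := by
  refine ⟨[⟨0, 0, 1, true⟩], ?_⟩
  simp only [Roe.Valid]
  refine ⟨by simp, by simp, Subgroup.one_mem _, ?_, ?_, ?_⟩
  · simpa [BalancedPresentation.trivial] using IsConj.refl (FreeGroup.of (0 : Fin 1))
  · ext i; simp [Fin.fin_one_eq_zero i]
  · ext i; simp [Fin.fin_one_eq_zero i]

end Examples

end Summit.SmoothPoincare4.SmoothPoincare4.Cruxes.DoublesBeyondShadowTwo.GradeFourAC
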